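import Mathlib
import HarnessLib
import Literature.Geometry.DiscreteGeometry.KissingPatterns

/-!
# Bonds of a `1/4`-matched soft link are pattern contacts (crux `SoftLayerPropagation`, line `Sketch`)

Route `PricedLinkCensus`, crux `SoftLayerPropagation` (stmt-AtomisticToContinuum-14233), line
`Sketch`, stub `stub_linkEdges`.  Twelve points `z j` with `1 ≤ ‖z j‖ ≤ (1+η) min 1 (n j)`,
`n j ≤ ‖z j‖`, `n j ≤ dist (z j) (z k)` (`j ≠ k`), `η ≤ 1/100`, and a rotated FCC/HCP pattern
`A P`; if `z j` is within `1/4` of `A p`, `z k` within `1/4` of `A q`, `j ≠ k` and the pair is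
BONDED (`dist (z j) (z k) ≤ (1+η) min (n j) (n k)`), then `dist p q = 1`.

Proof.  The pattern distances are `1`, `√2` or `≥ √(8/3)` (a `decide` over the integer models
`fccInt`, `hcpInt`).  `p = q` would put the two sites within `1/2 < 1/(1+η) ≤ n j` of each other;
`dist p q ≥ √(8/3) ≈ 1.63` is excluded by the triangle inequality (`dist p q ≤ 1/2 + (1+η)² ≤ 1.5201`);
and a square diagonal `√2` (`A p ⊥ A q`) is excluded by the two angular windows ALONE: a site of
norm `≥ 1` within `1/4` of a unit vector deviates from it by an angle of cosine `≥ 31/32`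
(`14.36°`), so two sites matched to orthogonal directions subtend an angle of cosine
`≤ sin (2 · 14.36°) = 31√63/512 ≈ 0.4806 < 9799/20000 ≤ 1 − (1+η)²/2`, against the bond window
`⟪z j, z k⟫ ≥ (1 − (1+η)²/2) ‖z j‖ ‖z k‖` (`Theorems.le_inner_of_bond`).  The trigonometry is done
in cosine form: one Bessel inequality, one Cauchy–Schwarz, and a polynomial certificate.
-/

noncomputable section

namespace Summit.AtomisticToContinuum.Crystallization.Theorems

open Literature.Geometry.DiscreteGeometry

/-! ### The distance spectrum of the two patterns -/

/-- In a scaled integer pattern `{v/√N}`, `dist (v/√N) (w/√N)² = |v − w|² / N`. [folklore] -/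
theorem dist_sq_scaled_intVec {N : ℕ} (hN : N ≠ 0) (v w : Fin 3 → ℤ) :
    dist ((Real.sqrt N)⁻¹ • intVec v : EuclideanSpace ℝ (Fin 3))
        ((Real.sqrt N)⁻¹ • intVec w) ^ 2 = (sqNormInt (v - w) : ℝ) / N := by
  have hpos : (0 : ℝ) < Real.sqrt N := by positivity
  have h0 : (0 : ℝ) ≤ (sqNormInt (v - w) : ℝ) := by
    have : (0 : ℤ) ≤ sqNormInt (v - w) := by unfold sqNormInt; positivity
    exact_mod_cast this
  rw [dist_eq_norm, ← smul_sub, intVec_sub, norm_smul, norm_inv, Real.norm_of_nonneg hpos.le,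
    norm_intVec, mul_pow, inv_pow, Real.sq_sqrt (Nat.cast_nonneg _), Real.sq_sqrt h0,
    div_eq_inv_mul]

/-- Differences of two minimal vectors of `D₃` have squared norm `0`, `2`, `4` or `≥ 16/3`
(in fact `6` or `8`). [folklore] -/
theorem sqNormInt_sub_fccInt_spectrum : ∀ v ∈ fccInt, ∀ w ∈ fccInt,
    v = w ∨ sqNormInt (v - w) = (2 : ℕ) ∨ sqNormInt (v - w) = 2 * (2 : ℕ) ∨
      8 * ((2 : ℕ) : ℤ) ≤ 3 * sqNormInt (v - w) := by
  decide

/-- Differences of two vectors of the integer HCP model have squared norm `0`, `18`, `36` or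
`≥ 48`. [folklore] -/
theorem sqNormInt_sub_hcpInt_spectrum : ∀ v ∈ hcpInt, ∀ w ∈ hcpInt,
    v = w ∨ sqNormInt (v - w) = (18 : ℕ) ∨ sqNormInt (v - w) = 2 * (18 : ℕ) ∨
      8 * ((18 : ℕ) : ℤ) ≤ 3 * sqNormInt (v - w) := by
  decide

/-- **Distance spectrum of a scaled integer pattern.**  If all `v ∈ S` have squared norm `N` and
all differences have squared norm `0`, `N`, `2N` or `≥ 8N/3`, then two points of `{v/√N : v ∈ S}`
coincide, are at distance `1`, are orthogonal unit vectors, or are at squared distance `≥ 8/3`.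
[folklore] -/
theorem scaledPattern_dist_cases {S : Finset (Fin 3 → ℤ)} {N : ℕ} (hN : N ≠ 0)
    (hS : ∀ v ∈ S, sqNormInt v = N)
    (hspec : ∀ v ∈ S, ∀ w ∈ S, v = w ∨ sqNormInt (v - w) = N ∨ sqNormInt (v - w) = 2 * N ∨
      8 * (N : ℤ) ≤ 3 * sqNormInt (v - w))
    {p q : EuclideanSpace ℝ (Fin 3)} (hp : p ∈ scaledPattern S N) (hq : q ∈ scaledPattern S N) :
    p = q ∨ dist p q = 1 ∨ (‖p‖ = 1 ∧ ‖q‖ = 1 ∧ inner ℝ p q = 0) ∨ 8 / 3 ≤ dist p q ^ 2 := by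
  have hp1 := norm_eq_one_of_mem_scaledPattern hN hS hp
  have hq1 := norm_eq_one_of_mem_scaledPattern hN hS hq
  obtain ⟨v, hv, rfl⟩ := Finset.mem_image.1 hp
  obtain ⟨w, hw, rfl⟩ := Finset.mem_image.1 hq
  have hsq := dist_sq_scaled_intVec hN v w
  have hNpos : (0 : ℝ) < N := by positivity
  rcases hspec v hv w hw with h | h | h | h
  · left; rw [h]
  · right; left
    have h2 : dist ((Real.sqrt N)⁻¹ • intVec v : EuclideanSpace ℝ (Fin 3))
        ((Real.sqrt N)⁻¹ • intVec w) ^ 2 = 1 := by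
      rw [hsq, h, Int.cast_natCast, div_self hNpos.ne']
    rw [← Real.sqrt_sq (dist_nonneg (x := ((Real.sqrt N)⁻¹ • intVec v : EuclideanSpace ℝ (Fin 3)))
      (y := (Real.sqrt N)⁻¹ • intVec w)), h2, Real.sqrt_one]
  · right; right; left
    refine ⟨hp1, hq1, ?_⟩
    have h2 : dist ((Real.sqrt N)⁻¹ • intVec v : EuclideanSpace ℝ (Fin 3))
        ((Real.sqrt N)⁻¹ • intVec w) ^ 2 = 2 := by
      rw [hsq, h]; push_cast; field_simp
    rw [dist_eq_norm, norm_sub_sq_real, hp1, hq1] at h2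
    linarith
  · right; right; right
    rw [hsq, le_div_iff₀ hNpos]
    have : (8 * (N : ℝ)) ≤ 3 * (sqNormInt (v - w) : ℝ) := by exact_mod_cast h
    linarith

/-! ### The angular exclusion of square diagonals -/

/-- **Polynomial certificate.**  With `r, s ≥ 1` the norms of two sites, `α = ⟪u, a⟫`,
`β = ⟪u, b⟫`, `δ = ⟪v, b⟫` for orthonormal `a, b` with `‖u − a‖, ‖v − b‖ ≤ 1/4` (so
`r² − 2α + 1 ≤ 1/16`, `s² − 2δ + 1 ≤ 1/16`), Bessel `α² + β² ≤ r²`, `δ ≤ s`, and the Cauchy–Schwarz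
bound `T² ≤ (r² − β²)(s² − δ²)` for the inner product `T` of the components orthogonal to `b`:
`βδ + T < (9799/20000) r s`.  (Extremal value `31√63/512 ≈ 0.48058`.) [folklore] -/
theorem inner_lt_of_matched_orthogonal_cert {r s α β δ T : ℝ} (hr : 1 ≤ r) (hs : 1 ≤ s)
    (hα : r ^ 2 - 2 * α + 1 ≤ 1 / 16) (hδ : s ^ 2 - 2 * δ + 1 ≤ 1 / 16)
    (hB : α ^ 2 + β ^ 2 ≤ r ^ 2) (hδs : δ ≤ s)
    (hT : T * T ≤ (r ^ 2 - β ^ 2) * (s ^ 2 - δ ^ 2)) :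
    β * δ + T < 9799 / 20000 * (r * s) := by
  have hr0 : 0 ≤ r := by linarith
  have hs0 : 0 ≤ s := by linarith
  -- the matched directions: `α ≥ 31 r / 32`, `δ ≥ 31 s / 32` (as `(r - 1) (r - 15/16) ≥ 0`)
  have hα1 : 31 / 32 * r ≤ α := by
    linarith [mul_nonneg (sub_nonneg.2 hr) (by linarith : (0 : ℝ) ≤ r - 15 / 16)]
  have hδ1 : 31 / 32 * s ≤ δ := by
    linarith [mul_nonneg (sub_nonneg.2 hs) (by linarith : (0 : ℝ) ≤ s - 15 / 16)]
  have hδ0 : 0 ≤ δ := by linarith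
  -- Bessel: `β² ≤ 63 r² / 1024 < r² / 16`, so `|β| ≤ r / 4`
  have hβ2 : β ^ 2 ≤ 63 / 1024 * r ^ 2 := by
    linarith [mul_nonneg (sub_nonneg.2 hα1) (by linarith : 0 ≤ α + 31 / 32 * r)]
  have hr2 : 1 ≤ r ^ 2 := by linarith [mul_nonneg (sub_nonneg.2 hr) hr0]
  have hβu : β ≤ r / 4 := by
    rcases le_or_gt β (r / 4) with h | h
    · exact h
    · linarith [mul_pos (by linarith : 0 < β - r / 4) (by linarith : 0 < β + r / 4)]
  have hβl : -(r / 4) ≤ β := by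
    rcases le_or_gt (-(r / 4)) β with h | h
    · exact h
    · linarith [mul_pos (by linarith : 0 < -(r / 4) - β) (by linarith : 0 < r / 4 - β)]
  have hrs : 0 ≤ r * s := mul_nonneg hr0 hs0
  have hrs1 : 1 ≤ r * s := by linarith [mul_nonneg (sub_nonneg.2 hr) (sub_nonneg.2 hs)]
  rcases lt_or_ge (β * δ + T) (9799 / 20000 * (r * s)) with h | h
  · exact h
  exfalso
  -- `T ≥ κ₀ r s − β δ ≥ 0`, so square
  have hβδ : β * δ ≤ r / 4 * s :=
    (mul_le_mul_of_nonneg_right hβu hδ0).trans (mul_le_mul_of_nonneg_left hδs (by linarith))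
  have hpos : 0 ≤ 9799 / 20000 * (r * s) - β * δ := by linarith
  have hT0 : 9799 / 20000 * (r * s) - β * δ ≤ T := by linarith
  have hT2 : (9799 / 20000 * (r * s) - β * δ) * (9799 / 20000 * (r * s) - β * δ) ≤ T * T :=
    mul_self_le_mul_self hpos hT0
  -- monotonicity in `β` (decreasing up to `r/4`) and in `δ` (increasing from `31 s/32`)
  have hrδ : r * (31 / 32 * s) ≤ r * δ := mul_le_mul_of_nonneg_left hδ1 hr0
  have hβs : β * s ≤ r / 4 * s := mul_le_mul_of_nonneg_right hβu hs0
  have hint1 : 0 ≤ (r / 4 - β) * s * (9799 / 10000 * r * δ - β * s - r * s / 4) := by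
    apply mul_nonneg (mul_nonneg (by linarith) hs0)
    linarith
  have hint2 : 0 ≤ r ^ 2 * ((δ - 31 / 32 * s) * (δ + 31 / 32 * s - 9799 / 40000 * s)) := by
    apply mul_nonneg (sq_nonneg r)
    exact mul_nonneg (by linarith) (by linarith)
  -- the corner value `1025/1024 − 31 κ₀/64 > 1 − κ₀²`
  have hrs2 : 1 ≤ r * s * (r * s) := one_le_mul_of_one_le_of_one_le hrs1 hrs1
  linarith [hint1, hint2, hT2, hT, hrs2]

/-- **Two sites matched to orthogonal directions are not bonded (cosine form).**  In a real inner
product space, if `a ⊥ b` are unit vectors, `‖u‖, ‖v‖ ≥ 1`, `dist u a ≤ 1/4` and `dist v b ≤ 1/4`,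
then `⟪u, v⟫ < (9799/20000) ‖u‖ ‖v‖` (the sites subtend more than `arcsin (31√63/512) ≈ 61.28°`,
and `9799/20000 = 1 − (101/100)²/2` is the bond cosine at `η = 1/100`). [folklore] -/
theorem inner_lt_of_matched_orthogonal {E : Type*} [NormedAddCommGroup E] [InnerProductSpace ℝ E]
    {u v a b : E} (ha : ‖a‖ = 1) (hb : ‖b‖ = 1) (hab : inner ℝ a b = 0)
    (hu : 1 ≤ ‖u‖) (hv : 1 ≤ ‖v‖) (hua : dist u a ≤ 1 / 4) (hvb : dist v b ≤ 1 / 4) :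
    inner ℝ u v < 9799 / 20000 * (‖u‖ * ‖v‖) := by
  have hba : inner ℝ b a = 0 := by rw [real_inner_comm]; exact hab
  -- the two matching discs in cosine form
  have hα : ‖u‖ ^ 2 - 2 * inner ℝ u a + 1 ≤ 1 / 16 := by
    have h1 : ‖u - a‖ ^ 2 ≤ (1 / 4) ^ 2 := by
      rw [← dist_eq_norm]; exact pow_le_pow_left₀ dist_nonneg hua 2
    rw [norm_sub_sq_real, ha] at h1
    linarith
  have hδ : ‖v‖ ^ 2 - 2 * inner ℝ v b + 1 ≤ 1 / 16 := by
    have h1 : ‖v - b‖ ^ 2 ≤ (1 / 4) ^ 2 := by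
      rw [← dist_eq_norm]; exact pow_le_pow_left₀ dist_nonneg hvb 2
    rw [norm_sub_sq_real, hb] at h1
    linarith
  -- Bessel for `u` against the orthonormal pair `a, b`
  have hB : inner ℝ u a ^ 2 + inner ℝ u b ^ 2 ≤ ‖u‖ ^ 2 := by
    have h0 : 0 ≤ inner ℝ (u - inner ℝ u a • a - inner ℝ u b • b)
        (u - inner ℝ u a • a - inner ℝ u b • b) := real_inner_self_nonneg
    have hexp : inner ℝ (u - inner ℝ u a • a - inner ℝ u b • b)
        (u - inner ℝ u a • a - inner ℝ u b • b) =
          ‖u‖ ^ 2 - inner ℝ u a ^ 2 - inner ℝ u b ^ 2 := by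
      simp only [inner_sub_left, inner_sub_right, inner_smul_left, inner_smul_right,
        real_inner_self_eq_norm_sq, ha, hb, hab, hba, real_inner_comm a u, real_inner_comm b u,
        RCLike.conj_to_real]
      ring
    linarith
  -- `δ ≤ s`
  have hδs : inner ℝ v b ≤ ‖v‖ := by
    have := real_inner_le_norm v b
    rwa [hb, mul_one] at this
  -- Cauchy–Schwarz for the components orthogonal to `b`
  have hT : (inner ℝ u v - inner ℝ u b * inner ℝ v b) * (inner ℝ u v - inner ℝ u b * inner ℝ v b) ≤
      (‖u‖ ^ 2 - inner ℝ u b ^ 2) * (‖v‖ ^ 2 - inner ℝ v b ^ 2) := by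
    have hcs := real_inner_mul_inner_self_le (u - inner ℝ u b • b) (v - inner ℝ v b • b)
    have e1 : inner ℝ (u - inner ℝ u b • b) (v - inner ℝ v b • b) =
        inner ℝ u v - inner ℝ u b * inner ℝ v b := by
      simp only [inner_sub_left, inner_sub_right, inner_smul_left, inner_smul_right,
        real_inner_self_eq_norm_sq, hb, real_inner_comm b u, real_inner_comm b v,
        RCLike.conj_to_real]
      ring
    have e2 : inner ℝ (u - inner ℝ u b • b) (u - inner ℝ u b • b) = ‖u‖ ^ 2 - inner ℝ u b ^ 2 := by
      simp only [inner_sub_left, inner_sub_right, inner_smul_left, inner_smul_right,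
        real_inner_self_eq_norm_sq, hb, real_inner_comm b u, RCLike.conj_to_real]
      ring
    have e3 : inner ℝ (v - inner ℝ v b • b) (v - inner ℝ v b • b) = ‖v‖ ^ 2 - inner ℝ v b ^ 2 := by
      simp only [inner_sub_left, inner_sub_right, inner_smul_left, inner_smul_right,
        real_inner_self_eq_norm_sq, hb, real_inner_comm b v, RCLike.conj_to_real]
      ring
    rw [e1, e2, e3] at hcs
    exact hcs
  have key := inner_lt_of_matched_orthogonal_cert hu hv hα hδ hB hδs hT
  linarith

/-! ### The stub -/

/-- **stub_linkEdges** (13 points, analytic; stub of line `Sketch`, crux `SoftLayerPropagation`).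
In the situation of the twelve-point soft link theorem, once a rotated pattern `A P`
(`P` the FCC or the HCP kissing pattern) is `1/4`-matched to the twelve points, two BONDED points
are matched to pattern points at distance exactly `1` (pattern-adjacent): no bond of the soft link
runs along a square diagonal (`√2`) of the pattern, and all longer pattern distances (`≥ √(8/3)`)
are excluded by the triangle inequality alone. -/
theorem stub_linkEdges : ∀ η : ℝ, 0 < η → η ≤ 1 / 100 →
      ∀ (z : Fin 12 → EuclideanSpace ℝ (Fin 3)) (n : Fin 12 → ℝ),
        (∀ j, 1 ≤ ‖z j‖) →
        (∀ j, ‖z j‖ ≤ (1 + η) * min 1 (n j)) →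
        (∀ j, n j ≤ ‖z j‖) →
        (∀ j k, j ≠ k → n j ≤ dist (z j) (z k)) →
        (∀ j, (Finset.univ.filter (fun k : Fin 12 =>
            k ≠ j ∧ dist (z j) (z k) ≤ (1 + η) * min (n j) (n k))).card = 4) →
        ∀ (A : EuclideanSpace ℝ (Fin 3) →ₗᵢ[ℝ] EuclideanSpace ℝ (Fin 3))
          (P : Finset (EuclideanSpace ℝ (Fin 3))),
          (P = Literature.Geometry.DiscreteGeometry.fccKissingPattern ∨
            P = Literature.Geometry.DiscreteGeometry.hcpKissingPattern) →
          (∀ p ∈ P, ∃ j : Fin 12, dist (z j) (A p) ≤ 1 / 4) →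
          ∀ p ∈ P, ∀ q ∈ P, ∀ j k : Fin 12,
            dist (z j) (A p) ≤ 1 / 4 → dist (z k) (A q) ≤ 1 / 4 → j ≠ k →
            dist (z j) (z k) ≤ (1 + η) * min (n j) (n k) → dist p q = 1 := by
  intro η hη hη1 z n h1 h2 h3 h4 _h5 A P hP _hmatch p hp q hq j k hjp hkq hjk hbond
  -- the four-way split on the pattern pair
  have hsplit : p = q ∨ dist p q = 1 ∨ (‖p‖ = 1 ∧ ‖q‖ = 1 ∧ inner ℝ p q = 0) ∨
      8 / 3 ≤ dist p q ^ 2 := by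
    rcases hP with rfl | rfl
    · exact scaledPattern_dist_cases two_ne_zero sqNormInt_fccInt sqNormInt_sub_fccInt_spectrum
        hp hq
    · exact scaledPattern_dist_cases (by norm_num) sqNormInt_hcpInt sqNormInt_sub_hcpInt_spectrum
        hp hq
  -- basic bounds on the bonded pair
  have hm0 : (0 : ℝ) < 1 + η := by linarith
  have hzj : ‖z j‖ ≤ 1 + η :=
    (h2 j).trans ((mul_le_mul_of_nonneg_left (min_le_left _ _) hm0.le).trans (mul_one _).le)
  have hznj : ‖z j‖ ≤ (1 + η) * n j :=
    (h2 j).trans (mul_le_mul_of_nonneg_left (min_le_right _ _) hm0.le)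
  have hnj : n j ≤ 1 + η := (h3 j).trans hzj
  have hbond' : dist (z j) (z k) ≤ (1 + η) * (1 + η) :=
    hbond.trans ((mul_le_mul_of_nonneg_left (min_le_left _ _) hm0.le).trans
      (mul_le_mul_of_nonneg_left hnj hm0.le))
  have hdz : dist (z j) (z k) ≤ 10201 / 10000 := by nlinarith
  -- `dist p q ≤ 1/2 + dist (z j) (z k)`
  have hpq : dist p q ≤ 1 / 2 + dist (z j) (z k) := by
    rw [← A.dist_map p q]
    calc dist (A p) (A q) ≤ dist (A p) (z j) + dist (z j) (z k) + dist (z k) (A q) :=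
          dist_triangle4 _ _ _ _
      _ ≤ 1 / 4 + dist (z j) (z k) + 1 / 4 := by
        rw [dist_comm (A p) (z j)]
        exact add_le_add (add_le_add hjp le_rfl) hkq
      _ = 1 / 2 + dist (z j) (z k) := by ring
  rcases hsplit with hpq0 | hone | ⟨hp1, hq1, hperp⟩ | hfar
  · -- `p = q`: the two sites are within `1/2` of each other, against the separation `n j`
    exfalso
    subst hpq0
    have hd : dist (z j) (z k) ≤ 1 / 2 := by
      calc dist (z j) (z k) ≤ dist (z j) (A p) + dist (z k) (A p) := dist_triangle_right _ _ _
        _ ≤ 1 / 4 + 1 / 4 := add_le_add hjp hkq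
        _ = 1 / 2 := by norm_num
    have hn : n j ≤ 1 / 2 := (h4 j k hjk).trans hd
    nlinarith [h1 j]
  · exact hone
  · -- a square diagonal: the angular windows clash
    exfalso
    -- the bond window in cosine form (adapted from `Theorems.le_inner_of_bond`,
    -- PricedLinkCensusSoftFourRingsReduction.lean): `⟪z j, z k⟫ ≥ (1 − (1+η)²/2) ‖z j‖ ‖z k‖`
    have hlow : (1 - (1 + η) ^ 2 / 2) * (‖z j‖ * ‖z k‖) ≤ inner ℝ (z j) (z k) := by
      have hd : dist (z j) (z k) ^ 2 = ‖z j‖ ^ 2 - 2 * inner ℝ (z j) (z k) + ‖z k‖ ^ 2 := by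
        rw [dist_eq_norm, norm_sub_sq_real]
      have hd0 : 0 ≤ dist (z j) (z k) := dist_nonneg
      have hρ0 : 0 ≤ ‖z j‖ := norm_nonneg _
      have hσ0 : 0 ≤ ‖z k‖ := norm_nonneg _
      have hdρ : dist (z j) (z k) ≤ (1 + η) * ‖z j‖ :=
        hbond.trans (mul_le_mul_of_nonneg_left ((min_le_left _ _).trans (h3 j)) hm0.le)
      have hdσ : dist (z j) (z k) ≤ (1 + η) * ‖z k‖ :=
        hbond.trans (mul_le_mul_of_nonneg_left ((min_le_right _ _).trans (h3 k)) hm0.le)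
      have key : 2 * ((1 - (1 + η) ^ 2 / 2) * (‖z j‖ * ‖z k‖)) ≤
          ‖z j‖ ^ 2 + ‖z k‖ ^ 2 - dist (z j) (z k) ^ 2 := by
        rcases le_total ‖z k‖ ‖z j‖ with hle | hle
        · have hd2 : dist (z j) (z k) ^ 2 ≤ (1 + η) ^ 2 * ‖z k‖ ^ 2 := by nlinarith [hdσ]
          nlinarith [mul_nonneg (mul_nonneg (sq_nonneg (1 + η)) hσ0) (sub_nonneg.2 hle),
            sq_nonneg (‖z j‖ - ‖z k‖)]
        · have hd2 : dist (z j) (z k) ^ 2 ≤ (1 + η) ^ 2 * ‖z j‖ ^ 2 := by nlinarith [hdρ]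
          nlinarith [mul_nonneg (mul_nonneg (sq_nonneg (1 + η)) hρ0) (sub_nonneg.2 hle),
            sq_nonneg (‖z j‖ - ‖z k‖)]
      nlinarith [key, hd]
    have hup := inner_lt_of_matched_orthogonal (u := z j) (v := z k) (a := A p) (b := A q)
      (by rw [A.norm_map, hp1]) (by rw [A.norm_map, hq1]) (by rw [A.inner_map_map, hperp])
      (h1 j) (h1 k) hjp hkq
    have hκ : (9799 / 20000 : ℝ) ≤ 1 - (1 + η) ^ 2 / 2 := by nlinarith
    have hpos : 0 ≤ ‖z j‖ * ‖z k‖ := by positivity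
    nlinarith [mul_le_mul_of_nonneg_right hκ hpos]
  · -- a longer pattern distance: excluded by the triangle inequality
    exfalso
    have hle : dist p q ≤ 1 / 2 + 10201 / 10000 := hpq.trans (by linarith)
    have : dist p q ^ 2 ≤ (1 / 2 + 10201 / 10000) ^ 2 := pow_le_pow_left₀ dist_nonneg hle 2
    nlinarith

end Summit.AtomisticToContinuum.Crystallization.Theorems

end
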